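import Summits.QuantumFields.YangMills.Theorems.BalabanUVNodesN27LedgerJoinTail
import Summits.QuantumFields.YangMills.Theorems.BalabanUVNodesN19LedgerLinkSync

/-!
# BalabanUVNodes ∕ N27 spine-record join, XI — THE TWIN OVER dag-n19-a's SYNCHRONISED LINK RECORD `LedgerAtSync` (v4 letter: τ-free
# reference ledger + booking, other kinds through node U5b's `FactorLogRatio`, NO hazard-H-U5b-1 field; N16 as `NE3Shape`), budget clause
# discharged in the tail as in file IX: one string · the ∃-package under the prefix · the DECL-column form with N17 itself
# (cell `pub-ymgap`, HUMAN RULING D-0062 Track A, seat `pub-ymgap-dag-n27-a` g3; `--supports stmt-QuantumFields-19182`, count-neutral)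

WHY.  Two Link records are in the tree: dag-n19-b's `N19SizeWindow.LedgerAt` (p413834, v1′ letter; consumed by files VI–X of this seat)
and dag-n19-a's `N19LedgerLinkSync.LedgerAtSync` (p414645, 2026-08-26T00:46Z; the v4 letter = EXACTLY the non-edge binders of
`N19OtherKindsU5b.core_summable_of_nodes_u5b`, with `one : C.transport oneB = oneA` and the other-kinds centre clause instead of hazard
H-U5b-1, and N16 consumed as `NE3Shape` with BOTH conjuncts).  dag-n19-a asked for the re-base by name ([DAGN19A-G2-…] INBOX l.10158 ∕
l.10169: «re-base on `LedgerAtSync` ∕ `core_summable_of_ledgerAtSync` when it lands»); THIS module is that twin, so the rev-1 K5 text may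
cite EITHER Link record and find the N27 side ready.  Everything else is as in files VII–IX: per-string ∃-package under the targets'
prefix, clamped run tables `K ↦ extd (prefixOf (runFlow D g₀ (K₀ + K)) (K₀ + K))` with box AND windows read off `Tuned`, N17 either as
its out-edge `hU2` or ITSELF on dag-n17-a's AF-free gap road, and NO budget clause (`hybridNE7_of_core_tail`, typing decision (Z3)).

WHAT IS KERNEL-CHECKED ([bookkeeping] ∕ [folklore]; 0 `def`, 0 `sorry`).
* §1 `stringHybridNE7_of_ledgerAtSync_tail` — ONE STRING: N20 · N21 · E1∕E2 from `K₀` on · `LedgerAtSync L …` on the shell-free cores ·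
  N22 · N18 · N16 `NE3Shape` + liaison · `LipBackground`∕`PolyLipGrowth` · N17's out-edge `InjectedRate` on the box · windows ⇒
  `∃ K₁, StringHybridNE7 S os l₀ vol (K₀ + K₁)` (`core_summable_of_ledgerAtSync` then IX §1).
* §2 `hybridNE7Under_of_ledgerSyncPackage_tuned_tail` — THE DATUM, ∃-package with `LedgerAtSync` at the clamped tables, `hU2` under
  the prefix ⇒ `T4ApexHybrid.HybridNE7Under D Hβ`.
* §3 `hybridNE7Under_of_declColumnsSync_tail` — THE DATUM, every K4 child by its DECL column (N16 `NE3Shape`, N17 `NE4OnData D` + node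
  U2's moduli + one printed-type β bound, N18 `NE5`, N22 `NE9 ∧ FadingMemory`) + the `LedgerAtSync` package ⇒ `HybridNE7Under D Hβ`.

HONEST FRAMING.  COMPOSITE-node bookkeeping with the children's children as hypotheses: NE3∕NE4∕NE5∕NE9∕NE7b∕NE7c are HYPOTHESIS SHAPES
(none printed for Bałaban's d = 4 procedure, none proved); `LedgerAtSync` is NODE O content typed by dag-n19-a; nothing of Bałaban's objects
is instantiated; NO node is discharged; (B) and `Hβ` are antecedents, used, never refuted; one fixed finite four-torus — NOT ℝ⁴, NOT infinite
volume, NOT OS axioms, NOT a mass gap, NOT Clay.  Typed 28∕28; the discharged count is not touched by this file.  No decl below carries a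
cite tag.
-/

open Finset MeasureTheory

namespace Summit.QuantumFields.YangMills.Theorems.BalabanUVNodesN27SpineRecord

open Literature.MathematicalPhysics.QuantumFieldTheory.Balaban1983to89
open Literature.MathematicalPhysics.QuantumFieldTheory.Balaban1983to89.FlowStep (HBeta BetaUpperH)
open Literature.MathematicalPhysics.QuantumFieldTheory.Balaban1983to89.T4CouplingMatching (ScaleShiftRate HistLipschitz)
open Literature.MathematicalPhysics.QuantumFieldTheory.Balaban1983to89.T4Continuum
open T4OutputRate T4RecentScale T4GoodClassBudget T4CauchySum T4TowerRateComposition T4TowerRateDischarge T4TermwiseBudget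
open T4WeightBudget (RelWeightBound)
open T4IndicatorShell (ShellWeightBound)
open T4MatchingAssembly (HybridNE7 StringHybridNE7)
open T4EtaRateMin (Readings NE3Shape)
open T4RateLiaison (GaugeDominated)
open T4ContinuumYM4Torus (ForSmallCouplings)
open T4FlagMemory (extd)
open FlowStep (prefixOf)
open Summit.QuantumFields.BalabanUV.T4Continuum.Spine
open Summit.QuantumFields.BalabanUV.T4Continuum.Spine.NE4 (NE4OnData U2Output runFlow)
open Summit.QuantumFields.YangMills.BalabanUVNodes.N19LedgerLinkSync (LedgerDataSync LedgerAtSync core_summable_of_ledgerAtSync)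
open Summit.QuantumFields.YangMills.Theorems.BalabanUVNodesN17 (u2Output_under_of_N17_gap)

/-! ## §1 One string from the synchronised ledger predicate, the budget clause not asked -/

section SchemeLedger

variable {G : Type*} [GaugeGroup G] [MeasurableSpace G] [HaarData G] {O : Type*}
  {C : Carriers} [DecidableEq C.Dom] {Fk : Type*} {ι X : Type} [MeasurableSpace ι] {σ : Type} [DecidableEq σ]
  {L : LedgerDataSync C Fk ι σ} {l₀ vol : ℝ}
  {T : ℕ → Finset σ} {Bad : ℕ → ℝ → Finset σ} {A B shA shB : ℕ → ℝ → σ → ℝ} {W Wsh : ℕ → ℝ}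
  {R : Readings ι X} {Wset : Set (ℕ → ℝ)} {EA : Functional C C.BgA} {EB : Functional C C.BgB}
  {κ θ₅ C₅ C₉ ω θc Cd γ C₃ θ₃ P : ℝ} {q : ℕ} {Λm : ℕ → ℕ → ℝ} {CU : (ℕ → ℝ) → ℕ → ℝ} {g : ℕ → ℕ → ℝ}
  {uA : ℕ → ι → C.BgA} {uB : ℕ → ι → C.BgB}

/-- **ONE STRING FROM THE SYNCHRONISED LEDGER PREDICATE, THE BUDGET CLAUSE NOT ASKED.**  N20 `RelWeightBound` · N21 `ShellWeightBound` · the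
E1∕E2 dictionary from cutoff `K₀` on · **`hL : LedgerAtSync L l₀ vol T Bad (A − shA) (B − shB) R EA EB κ g uA uB ω θc θ₅ θ₃`** (dag-n19-a's
v4-letter record on the shell-free cores) · N16 `NE3Shape R C₃ θ₃` (both conjuncts) + liaison · N18 `NE5` · N22 `NE9 ∧ FadingMemory` ·
`LipBackground`∕`PolyLipGrowth` · N17's out-edge `InjectedRate Cd 0 θc disc` on the box · both tables in the window ⇒
`∃ K₁, StringHybridNE7 S os l₀ vol (K₀ + K₁)` — `core_summable_of_ledgerAtSync` (ONE line over `core_summable_of_nodes_u5b`) then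
`stringHybridNE7_of_spineNodes_tail` (IX §1).  CONDITIONAL on every binder; NE7∕NE7b∕NE7c NOT PRINTED, NOT proved. [bookkeeping] [folklore] -/
theorem stringHybridNE7_of_ledgerAtSync_tail (S : Missing.TorusScheme G O) (os : List O) (K₀ : ℕ)
    (h20 : RelWeightBound l₀ T A B Bad W) (h21 : ShellWeightBound l₀ T A B shA shB Wsh)
    (hE1 : ∀ (K : ℕ) (t : ℝ), |t| ≤ l₀ → T4GenFunBounds.schemeZ S os (K₀ + K) t = ∑ τ ∈ T K, A K t τ)
    (hE2 : ∀ (K : ℕ) (t : ℝ), |t| ≤ l₀ → T4GenFunBounds.schemeZ S os (K₀ + K + 1) t = ∑ τ ∈ T K, B K t τ)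
    (hL : LedgerAtSync L l₀ vol T Bad (fun K t τ => A K t τ - shA K t τ) (fun K t τ => B K t τ - shB K t τ)
      R EA EB κ g uA uB ω θc θ₅ θ₃)
    (h16 : NE3Shape R C₃ θ₃) (hC₃ : 0 ≤ C₃) (hgd : GaugeDominated R uA uB)
    (h18 : NE5 EA EB Wset κ θ₅ C₅) (hθ₅ : 0 ≤ θ₅) (hC₅ : 0 ≤ C₅)
    (h22 : NE9 EA Wset κ Λm ∧ FadingMemory C₉ ω Λm) (hω : 0 ≤ ω)
    (hinj : InjectedRate Cd 0 θc (fun K j => T4CouplingMatching.disc (g K) (g (K + 1)) j)) (hCd : 0 ≤ Cd)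
    (hθc : 0 ≤ θc) (hbox : ∀ K i, i ≤ K → 0 < g K i ∧ g K i ≤ γ)
    (hUL : LipBackground EA Wset κ CU) (hG : PolyLipGrowth CU g P q) (hP : 0 ≤ P)
    (hgA : ∀ K, g K ∈ Wset) (hgB : ∀ K, (fun i => g (K + 1) (i + 1)) ∈ Wset) :
    ∃ K₁, StringHybridNE7 S os l₀ vol (K₀ + K₁) :=
  stringHybridNE7_of_spineNodes_tail S os K₀ h20 h21
    (core_summable_of_ledgerAtSync hL h16 hC₃ hgd h18 hθ₅ hC₅ h22 hω hinj hCd hθc hbox hUL hG hP hgA hgB) hE1 hE2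

end SchemeLedger

/-! ## §2 The datum: the ∃-package with `LedgerAtSync` at the clamped tables, no budget clause -/

section Datum

variable {F : T4Family} {G : Type*} [GaugeGroup G] [MeasurableSpace G] [HaarData G]
  {C : Carriers} [DecidableEq C.Dom] {Fk : Type*} {ι X : Type} [MeasurableSpace ι]
  {R : Readings ι X} {Wset : Set (ℕ → ℝ)} {EA : Functional C C.BgA} {EB : Functional C C.BgB}
  {κ θ₅ C₅ C₉ ω C₃ θ₃ P γu : ℝ} {q : ℕ} {Λm : ℕ → ℕ → ℝ} {CU : (ℕ → ℝ) → ℕ → ℝ}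
  {uA : ℕ → ι → C.BgA} {uB : ℕ → ι → C.BgB}
  {c θ γ₄ C₄ ν β' : ℝ} {Λ₄ : ℕ → ℕ → ℝ}

/-- **N27 = B5 AT THE DATUM FROM A PER-STRING ∃-PACKAGE WITH THE SYNCHRONISED LINK RECORD, CLAMPED TABLES, NO BUDGET CLAUSE.**  TOP LEVEL,
BY NAME: N16 `h16 : NE3Shape R C₃ θ₃` + liaison `hgd`, N18 `h18 : NE5 EA EB Wset κ θ₅ C₅`, N22 `h22 : NE9 EA Wset κ Λm ∧ FadingMemory C₉ ω Λm`,
`hUL : LipBackground`, `hWin : Window γᵤ ⊆ Wset`, letter signs.  UNDER THE PREFIX: `hU2` — the edge N17 → N27 `U2Output D g₀ Cd θc`; `hPkg` —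
per string `∃ σ _ (L : LedgerDataSync C Fk ι σ) l₀ vol K₀ T Bad A B shA shB W Wsh` with `0 < l₀`, `0 < vol`, N20 `RelWeightBound`, N21
`ShellWeightBound`, E1∕E2 vs `schemeZ (D.scheme g₀) os (K₀ + K)`, `PolyLipGrowth` and **`LedgerAtSync L …`** at the clamped tables
`K ↦ extd (prefixOf (runFlow D g₀ (K₀ + K)) (K₀ + K))`.  Box AND windows READ OFF `Tuned` (γ-threshold shrunk to `min γ₀ γᵤ`), `hU2`
transferred (`injectedRate_clamped`), §1, the offset absorbed by `StringwiseHybridNE7`'s `∃ K₀`.  CONCLUSION: `T4ApexHybrid.HybridNE7Under D Hβ`.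
CONDITIONAL on every binder; nothing of Bałaban's instantiated; NOT a discharge. [bookkeeping] [folklore] -/
theorem hybridNE7Under_of_ledgerSyncPackage_tuned_tail (D : FiniteEpsData F G) {Hβ : Prop} {Cd θc : ℝ}
    (hγu : 0 < γu) (hWin : Window γu ⊆ Wset)
    (h16 : NE3Shape R C₃ θ₃) (hC₃ : 0 ≤ C₃) (hgd : GaugeDominated R uA uB)
    (h18 : NE5 EA EB Wset κ θ₅ C₅) (hθ₅ : 0 ≤ θ₅) (hC₅ : 0 ≤ C₅)
    (h22 : NE9 EA Wset κ Λm ∧ FadingMemory C₉ ω Λm) (hω : 0 ≤ ω)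
    (hUL : LipBackground EA Wset κ CU) (hP : 0 ≤ P) (hCd : 0 ≤ Cd) (hθc : 0 ≤ θc)
    (hU2 : D.UnderHypotheses Hβ fun g₀ => U2Output D g₀ Cd θc)
    (hPkg : D.UnderHypotheses Hβ fun g₀ => ∀ os : List (ULoop F),
      ∃ (σ : Type) (_ : DecidableEq σ) (L : LedgerDataSync C Fk ι σ) (l₀ vol : ℝ) (K₀ : ℕ) (T : ℕ → Finset σ)
        (Bad : ℕ → ℝ → Finset σ) (A B shA shB : ℕ → ℝ → σ → ℝ) (W Wsh : ℕ → ℝ),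
        0 < l₀ ∧ 0 < vol ∧ RelWeightBound l₀ T A B Bad W ∧ ShellWeightBound l₀ T A B shA shB Wsh ∧
        (∀ (K : ℕ) (t : ℝ), |t| ≤ l₀ → T4GenFunBounds.schemeZ (D.scheme g₀) os (K₀ + K) t = ∑ τ ∈ T K, A K t τ) ∧
        (∀ (K : ℕ) (t : ℝ), |t| ≤ l₀ → T4GenFunBounds.schemeZ (D.scheme g₀) os (K₀ + K + 1) t = ∑ τ ∈ T K, B K t τ) ∧
        PolyLipGrowth CU (fun K => extd (prefixOf (runFlow D g₀ (K₀ + K)) (K₀ + K))) P q ∧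
        LedgerAtSync L l₀ vol T Bad (fun K t τ => A K t τ - shA K t τ) (fun K t τ => B K t τ - shB K t τ) R EA EB κ
          (fun K => extd (prefixOf (runFlow D g₀ (K₀ + K)) (K₀ + K))) uA uB ω θc θ₅ θ₃) :
    T4ApexHybrid.HybridNE7Under D Hβ := by
  intro hB hβ
  have H1 : ForSmallCouplings D _ := hU2 hB hβ
  have H2 : ForSmallCouplings D _ := hPkg hB hβ
  obtain ⟨γ₀, hγ₀, Hγ⟩ := H1.and H2
  -- shrink the `γ`-threshold to `≤ γᵤ`, so that the tuned runs' window `Window γ` sits inside `Wset`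
  refine ⟨min γ₀ γu, lt_min hγ₀ hγu, fun γ hγ hγle => ?_⟩
  obtain ⟨g₁, hg₁, Hg⟩ := Hγ γ hγ (hγle.trans (min_le_left _ _))
  refine ⟨g₁, hg₁, fun gIR hgIR hgIRle g₀ ht os => ?_⟩
  obtain ⟨hu2, hpkg⟩ := Hg gIR hgIR hgIRle g₀ ht
  obtain ⟨σ, _, L, l₀, vol, K₀, T, Bad, A, B, shA, shB, W, Wsh, hl₀, hvol, h20, h21, hE1, hE2, hG, hL⟩ := hpkg os
  have hWγ : Window γ ⊆ Wset := fun h hh => hWin fun i => ⟨(hh i).1, (hh i).2.trans (hγle.trans (min_le_right _ _))⟩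
  -- the runs stay in `]0, γ]` (Tuned), so the clamped tables are in the window and in the box
  have hrun : ∀ K i, i ≤ K₀ + K → 0 < runFlow D g₀ (K₀ + K) i ∧ runFlow D g₀ (K₀ + K) i ≤ γ := fun K i hi =>
    (ht (K₀ + K)).1 i hi
  have hgA : ∀ K, extd (prefixOf (runFlow D g₀ (K₀ + K)) (K₀ + K)) ∈ Wset := fun K =>
    hWγ (extd_prefixOf_mem_window (hrun K))
  have hgB : ∀ K, (fun i => extd (prefixOf (runFlow D g₀ (K₀ + (K + 1))) (K₀ + (K + 1))) (i + 1)) ∈ Wset := fun K =>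
    hWγ (extd_prefixOf_succ_mem_window (hrun (K + 1)))
  have hbox : ∀ K i, i ≤ K → 0 < extd (prefixOf (runFlow D g₀ (K₀ + K)) (K₀ + K)) i ∧
      extd (prefixOf (runFlow D g₀ (K₀ + K)) (K₀ + K)) i ≤ γ := fun K i hi => by
    rw [T4FlagMemoryTwoRun.extd_prefixOf (show i ≤ K₀ + K by omega)]
    exact hrun K i (by omega)
  have hinj : InjectedRate Cd 0 θc fun K j => T4CouplingMatching.disc
      (extd (prefixOf (runFlow D g₀ (K₀ + K)) (K₀ + K))) (extd (prefixOf (runFlow D g₀ (K₀ + (K + 1))) (K₀ + (K + 1)))) j :=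
    injectedRate_clamped D hu2 K₀ (g := fun K => extd (prefixOf (runFlow D g₀ (K₀ + K)) (K₀ + K))) fun _ => rfl
  obtain ⟨K₁, hstr⟩ := stringHybridNE7_of_ledgerAtSync_tail (g := fun K => extd (prefixOf (runFlow D g₀ (K₀ + K)) (K₀ + K)))
    (D.scheme g₀) os K₀ h20 h21 hE1 hE2 hL h16 hC₃ hgd h18 hθ₅ hC₅ h22 hω hinj hCd hθc hbox hUL hG hP hgA hgB
  exact ⟨l₀, vol, K₀ + K₁, hl₀, hvol, hstr⟩

/-! ## §3 The datum: every K4 child by its DECL column + the synchronised Link record, no budget clause -/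

/-- **N27 = B5 AT THE DATUM FROM THE K4 CHILDREN'S DECL COLUMNS AND THE SYNCHRONISED K5 LINK RECORD, NO BUDGET CLAUSE** (§2 with `hU2`
REPLACED by N17 itself on dag-n17-a's AF-free gap road `u2Output_under_of_N17_gap`): N16 `NE3Shape R C₃ θ₃` + liaison, N17 `NE4OnData D c θ γ₄`
+ node U2's moduli `HistLipschitz Λ₄ γ₄ D.βfun`, `FadingMemory C₄ ν Λ₄` (`0 ≤ ν < θ < 1`) + the printed-type `BetaUpperH β′ γ₄ D.βfun`,
`γ₄²β′ < 1`, N18 `NE5`, N22 `NE9 ∧ FadingMemory`, `LipBackground`, `hWin`; under the prefix per string the ∃-package `0 < l₀`, `0 < vol`,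
N20 `RelWeightBound`, N21 `ShellWeightBound`, E1∕E2, `PolyLipGrowth`, `LedgerAtSync` (at `θc := θ`) at the clamped tables ⇒
`T4ApexHybrid.HybridNE7Under D Hβ`.  CONDITIONAL on every binder; none of NE3∕NE4∕NE5∕NE9∕NE7b∕NE7c is thereby proved; NOT a discharge.
[bookkeeping] [folklore] -/
theorem hybridNE7Under_of_declColumnsSync_tail (D : FiniteEpsData F G) {Hβ : Prop}
    (h16 : NE3Shape R C₃ θ₃) (hC₃ : 0 ≤ C₃) (hgd : GaugeDominated R uA uB)
    (h17 : NE4OnData D c θ γ₄) (hL4 : HistLipschitz Λ₄ γ₄ D.βfun) (hΛ4 : FadingMemory C₄ ν Λ₄)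
    (hc : 0 ≤ c) (hC₄ : 0 ≤ C₄) (hν0 : 0 ≤ ν) (hνθ : ν < θ) (hθ1 : θ < 1) (hγ₄ : 0 < γ₄)
    (hhi : BetaUpperH β' γ₄ D.βfun) (hγβ : γ₄ ^ 2 * β' < 1)
    (h18 : NE5 EA EB Wset κ θ₅ C₅) (hθ₅ : 0 ≤ θ₅) (hC₅ : 0 ≤ C₅)
    (h22 : NE9 EA Wset κ Λm ∧ FadingMemory C₉ ω Λm) (hω : 0 ≤ ω)
    (hUL : LipBackground EA Wset κ CU) (hP : 0 ≤ P) (hγu : 0 < γu) (hWin : Window γu ⊆ Wset)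
    (hPkg : D.UnderHypotheses Hβ fun g₀ => ∀ os : List (ULoop F),
      ∃ (σ : Type) (_ : DecidableEq σ) (L : LedgerDataSync C Fk ι σ) (l₀ vol : ℝ) (K₀ : ℕ) (T : ℕ → Finset σ)
        (Bad : ℕ → ℝ → Finset σ) (A B shA shB : ℕ → ℝ → σ → ℝ) (W Wsh : ℕ → ℝ),
        0 < l₀ ∧ 0 < vol ∧ RelWeightBound l₀ T A B Bad W ∧ ShellWeightBound l₀ T A B shA shB Wsh ∧
        (∀ (K : ℕ) (t : ℝ), |t| ≤ l₀ → T4GenFunBounds.schemeZ (D.scheme g₀) os (K₀ + K) t = ∑ τ ∈ T K, A K t τ) ∧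
        (∀ (K : ℕ) (t : ℝ), |t| ≤ l₀ → T4GenFunBounds.schemeZ (D.scheme g₀) os (K₀ + K + 1) t = ∑ τ ∈ T K, B K t τ) ∧
        PolyLipGrowth CU (fun K => extd (prefixOf (runFlow D g₀ (K₀ + K)) (K₀ + K))) P q ∧
        LedgerAtSync L l₀ vol T Bad (fun K t τ => A K t τ - shA K t τ) (fun K t τ => B K t τ - shB K t τ) R EA EB κ
          (fun K => extd (prefixOf (runFlow D g₀ (K₀ + K)) (K₀ + K))) uA uB ω θ θ₅ θ₃) :
    T4ApexHybrid.HybridNE7Under D Hβ :=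
  have hθ0 : 0 ≤ θ := hν0.trans hνθ.le
  hybridNE7Under_of_ledgerSyncPackage_tuned_tail D hγu hWin h16 hC₃ hgd h18 hθ₅ hC₅ h22 hω hUL hP
    (div_nonneg (mul_nonneg zero_le_two hc) (sub_nonneg.mpr hθ1.le)) hθ0
    (u2Output_under_of_N17_gap D h17 hL4 hΛ4 hc hC₄ hν0 hνθ hθ1 hγ₄ hhi hγβ) hPkg

end Datum

end Summit.QuantumFields.YangMills.Theorems.BalabanUVNodesN27SpineRecord
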